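import Summits.RiemannHypothesis.RiemannHypothesis.Theorems.AsymptoticCriticalLine.Negative.InteriorEdgeSplitStubs

/-!
# `AsymptoticCriticalLine` (crux stmt-RiemannHypothesis-2063): the accumulation-set picture

Periphery (calibration) file of the line `interior-edge-split` of the crux
`RuelleBand.AsymptoticCriticalLine` ("ACL": `∀ ε > 0, {s | ζ s = 0 ∧ 0 < Re s ∧ Re s < 1 ∧ ε ≤ |Re s − 1/2|}.Finite`),
lead prover-line-stmt-RiemannHypothesis-2063-c1.  Everything is written out over Mathlib's
`riemannZeta` (no new definitions); throughout, the *window* of radius `ε` around the abscissa `σ` is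
`W σ ε := {s | ζ s = 0 ∧ 0 < Re s ∧ Re s < 1 ∧ |Re s − σ| < ε}` and the *accumulation set of real
parts* (at infinite height) is

  `A := {σ : ℝ | ∀ ε > 0, (W σ ε).Infinite}`,

the set of abscissae every vertical neighbourhood of which holds infinitely many zeros of the open
critical strip.  ONE PICTURE for the crux and both registered stubs of the line:

* `acl_iff_reAccumulationSet` (the registered periphery stub) — `ACL ⟺ A = {1/2}`: the crux says the
  real parts of the zeros accumulate ONLY at `1/2` (⟹: a window of radius `|σ − 1/2|/2` around
  `σ ≠ 1/2` sits inside the finite band of that level; ⟸: cover the compact set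
  `[0, 1/2 − ε] ∪ [1/2 + ε, 1]` by finitely many finite windows, `IsCompact.elim_nhds_subcover`);
* `noRightInteriorBand_iff_reAccumulationSet` — stub 1 (`stub_noRightInteriorBand`) ⟺ `A ∩ (1/2, 1) = ∅`;
* `edgeZeroFreeStrip_iff_one_notMem_reAccumulationSet` — stub 2 (`stub_edgeZeroFreeStrip`, = route
  Strip's crux stmt-RiemannHypothesis-10660) ⟺ `1 ∉ A` (`Negative.windowOne_iff_edgeZeroFreeStrip`);
* UNCONDITIONAL STRUCTURE of `A`: `1/2 ∈ A` (`half_mem_reAccumulationSet`, Hardy 1914, PROVED in tree),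
  `A` is closed (`isClosed_reAccumulationSet`), symmetric under `σ ↦ 1 − σ`
  (`mem_reAccumulationSet_iff_one_sub`, functional equation) and `A ⊆ [0, 1]`
  (`reAccumulationSet_subset_Icc`); `σ ∉ A ⟺` some window around `σ` is finite
  (`notMem_reAccumulationSet_iff`).

So the split of the line reads off the picture: the crux is `A = {1/2}`, i.e. (given `1/2 ∈ A` and the
symmetry) `A ∩ (1/2, 1] = ∅`; stub 1 removes the open interval `(1/2, 1)`, stub 2 the endpoint `1`.

Census remark (prose only): at present NO point of `[0, 1]` is known to lie outside `A` — every
zero-free region in print has width `→ 0` as `|t| → ∞`, so it excludes no window, and zero-density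
theorems bound proportions `N(σ, T) ≪ T^{c(1−σ)} log^k T`, never the finiteness of a window.  Under RH,
`A = {1/2}`.
-/

noncomputable section

namespace Summit.RiemannHypothesis.RiemannHypothesis.Theorems.AsymptoticCriticalLine.InteriorEdgeSplit

open Complex Set
open Summit.RiemannHypothesis.RiemannHypothesis.Theses.RuelleBand (AsymptoticCriticalLine)
open Summit.RiemannHypothesis.RiemannHypothesis.Theorems.AsymptoticCriticalLine.Negative
  (bandSet acl_iff_bandSet window_infinite_of_reaches_half windowOne_iff_edgeZeroFreeStrip)

/-! ## 0. Membership in the accumulation set -/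

/-- An abscissa `σ` lies OUTSIDE the accumulation set `A` iff some window around it holds only
finitely many zeros of the open strip (`Set.Infinite = ¬ Set.Finite`). -/
theorem notMem_reAccumulationSet_iff (σ : ℝ) :
    σ ∉ {σ : ℝ | ∀ ε : ℝ, 0 < ε →
        {s : ℂ | riemannZeta s = 0 ∧ 0 < s.re ∧ s.re < 1 ∧ |s.re - σ| < ε}.Infinite} ↔
      ∃ ε : ℝ, 0 < ε ∧ {s : ℂ | riemannZeta s = 0 ∧ 0 < s.re ∧ s.re < 1 ∧ |s.re - σ| < ε}.Finite := by
  rw [mem_setOf_eq]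
  constructor
  · intro h
    by_contra hc
    exact h fun ε hε hfin => hc ⟨ε, hε, hfin⟩
  · rintro ⟨ε, hε, hfin⟩ h
    exact h ε hε hfin

/-- HARDY: `1/2 ∈ A` unconditionally — every window around the critical abscissa holds the
infinitely many critical zeros (`hardy_infinite_zeros_on_critical_line_holds`, PROVED in tree, through
`Negative.window_infinite_of_reaches_half`). -/
theorem half_mem_reAccumulationSet :
    (1 / 2 : ℝ) ∈ {σ : ℝ | ∀ ε : ℝ, 0 < ε →
        {s : ℂ | riemannZeta s = 0 ∧ 0 < s.re ∧ s.re < 1 ∧ |s.re - σ| < ε}.Infinite} := by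
  rw [mem_setOf_eq]
  intro ε hε
  exact window_infinite_of_reaches_half (by rwa [sub_self, abs_zero])

/-! ## 1. The crux: `ACL ⟺ A = {1/2}` -/

/-- THE ACCUMULATION-SET PICTURE OF THE CRUX (registered periphery stub of the line
`interior-edge-split`): `AsymptoticCriticalLine` holds iff the accumulation set of real parts is
exactly `{1/2}`.  ⟹: for `σ ≠ 1/2` the window of radius `|σ − 1/2|/2` lies inside the band of level
`|σ − 1/2|/2`, which is finite, so `σ ∉ A`; and `1/2 ∈ A` by Hardy.  ⟸ (only `A ⊆ {1/2}` is used):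
fix `ε > 0`; every point of the compact set `K = [0, 1/2 − ε] ∪ [1/2 + ε, 1]` is `≠ 1/2`, hence has a
finite window; finitely many of these windows cover `K` (`IsCompact.elim_nhds_subcover`), and every
zero of the band of level `ε` has its real part in `K`. -/
theorem acl_iff_reAccumulationSet :
    Summit.RiemannHypothesis.RiemannHypothesis.Theses.RuelleBand.AsymptoticCriticalLine ↔
      {σ : ℝ | ∀ ε : ℝ, 0 < ε →
        {s : ℂ | riemannZeta s = 0 ∧ 0 < s.re ∧ s.re < 1 ∧ |s.re - σ| < ε}.Infinite} = {1 / 2} := by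
  constructor
  · intro h
    ext σ
    rw [mem_singleton_iff]
    constructor
    · intro hσ
      by_contra hne
      have hpos : 0 < |σ - 1 / 2| := abs_pos.2 (sub_ne_zero.2 hne)
      refine (notMem_reAccumulationSet_iff σ).2 ⟨|σ - 1 / 2| / 2, by positivity,
        (acl_iff_bandSet.1 h (|σ - 1 / 2| / 2) (by positivity)).subset ?_⟩ hσ
      rintro s ⟨hz, h0, h1, hs⟩
      refine ⟨hz, h0, h1, ?_⟩
      have htri : |σ - 1 / 2| ≤ |σ - s.re| + |s.re - 1 / 2| := abs_sub_le σ s.re (1 / 2)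
      rw [abs_sub_comm] at hs
      linarith
    · rintro rfl
      exact half_mem_reAccumulationSet
  · intro hA
    refine acl_iff_bandSet.2 fun ε hε => ?_
    have hK : IsCompact (Icc (0 : ℝ) (1 / 2 - ε) ∪ Icc (1 / 2 + ε) 1) :=
      isCompact_Icc.union isCompact_Icc
    have hloc : ∀ x ∈ Icc (0 : ℝ) (1 / 2 - ε) ∪ Icc (1 / 2 + ε) 1, ∃ r : ℝ, 0 < r ∧
        {s : ℂ | riemannZeta s = 0 ∧ 0 < s.re ∧ s.re < 1 ∧ |s.re - x| < r}.Finite := by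
      intro x hx
      have hx' : x ≠ 1 / 2 := by
        rintro rfl
        rcases hx with ⟨_, h⟩ | ⟨h, _⟩ <;> linarith
      refine (notMem_reAccumulationSet_iff x).1 ?_
      rw [hA, mem_singleton_iff]
      exact hx'
    choose! r hr hfin using hloc
    obtain ⟨t, htK, hcover⟩ := hK.elim_nhds_subcover (fun x => Ioo (x - r x) (x + r x))
      (fun x hx => Ioo_mem_nhds (by linarith [hr x hx]) (by linarith [hr x hx]))
    refine ((t.finite_toSet).biUnion fun x hx => hfin x (htK x hx)).subset ?_
    rintro s ⟨hz, h0, h1, hs⟩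
    have hsK : s.re ∈ Icc (0 : ℝ) (1 / 2 - ε) ∪ Icc (1 / 2 + ε) 1 := by
      rcases le_abs.1 hs with h | h
      · exact Or.inr ⟨by linarith, h1.le⟩
      · exact Or.inl ⟨h0.le, by linarith⟩
    obtain ⟨x, hxt, hsx⟩ := mem_iUnion₂.1 (hcover hsK)
    refine mem_iUnion₂.2 ⟨x, hxt, hz, h0, h1, ?_⟩
    rw [abs_sub_lt_iff]
    exact ⟨by linarith [hsx.2], by linarith [hsx.1]⟩

/-! ## 2. The two stubs of the line in the same picture -/

/-- STUB 1 (`stub_noRightInteriorBand`: every `σ₀ ∈ (1/2, 1)` has a finite window) says exactly that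
the accumulation set misses the open right half `(1/2, 1)` of the strip (nearly definitional:
`σ ∉ A ⟺` some window around `σ` is finite). -/
theorem noRightInteriorBand_iff_reAccumulationSet :
    (∀ σ₀ : ℝ, 1 / 2 < σ₀ → σ₀ < 1 → ∃ ε : ℝ, 0 < ε ∧
        {s : ℂ | riemannZeta s = 0 ∧ 0 < s.re ∧ s.re < 1 ∧ |s.re - σ₀| < ε}.Finite) ↔
      {σ : ℝ | ∀ ε : ℝ, 0 < ε →
          {s : ℂ | riemannZeta s = 0 ∧ 0 < s.re ∧ s.re < 1 ∧ |s.re - σ| < ε}.Infinite} ∩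
        Set.Ioo (1 / 2) 1 = ∅ := by
  rw [eq_empty_iff_forall_notMem]
  constructor
  · rintro h σ ⟨hA, h1, h2⟩
    exact (notMem_reAccumulationSet_iff σ).2 (h σ h1 h2) hA
  · intro h σ₀ h1 h2
    refine (notMem_reAccumulationSet_iff σ₀).1 fun hA => ?_
    exact h σ₀ ⟨hA, h1, h2⟩

/-- STUB 2 (`stub_edgeZeroFreeStrip`, verbatim route Strip's crux `StripZeroFreeStrip`: a zero-free
vertical strip `1 − δ < Re s < 1`) says exactly that the edge abscissa `1` is not an accumulation
point: a finite window at `σ = 1` shrinks to a zero-free one (`Negative.windowOne_iff_edgeZeroFreeStrip`,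
there is no finite-exception rung on the edge side). -/
theorem edgeZeroFreeStrip_iff_one_notMem_reAccumulationSet :
    (∃ δ : ℝ, 0 < δ ∧ ∀ s : ℂ, riemannZeta s = 0 → 1 - δ < s.re → s.re < 1 → False) ↔
      (1 : ℝ) ∉ {σ : ℝ | ∀ ε : ℝ, 0 < ε →
        {s : ℂ | riemannZeta s = 0 ∧ 0 < s.re ∧ s.re < 1 ∧ |s.re - σ| < ε}.Infinite} := by
  rw [← windowOne_iff_edgeZeroFreeStrip, notMem_reAccumulationSet_iff]

/-! ## 3. Unconditional structure of the accumulation set -/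

/-- `A` is CLOSED: if `σ ∉ A`, some window of radius `r` around `σ` is finite, and then the window of
radius `r/2` around any `σ'` with `|σ' − σ| < r/2` lies inside it, so `σ' ∉ A`. -/
theorem isClosed_reAccumulationSet :
    IsClosed {σ : ℝ | ∀ ε : ℝ, 0 < ε →
        {s : ℂ | riemannZeta s = 0 ∧ 0 < s.re ∧ s.re < 1 ∧ |s.re - σ| < ε}.Infinite} := by
  rw [← isOpen_compl_iff, Metric.isOpen_iff]
  intro σ hσ
  rw [mem_compl_iff, notMem_reAccumulationSet_iff] at hσ
  obtain ⟨r, hr, hfin⟩ := hσ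
  refine ⟨r / 2, by positivity, fun σ' hσ' => ?_⟩
  rw [Metric.mem_ball, Real.dist_eq] at hσ'
  rw [mem_compl_iff, notMem_reAccumulationSet_iff]
  refine ⟨r / 2, by positivity, hfin.subset ?_⟩
  rintro s ⟨hz, h0, h1, hs⟩
  refine ⟨hz, h0, h1, ?_⟩
  rw [abs_sub_lt_iff] at hs hσ' ⊢
  exact ⟨by linarith [hs.1, hσ'.1], by linarith [hs.2, hσ'.2]⟩

/-- One direction of the symmetry: `σ ∈ A → 1 − σ ∈ A` (reflection `s ↦ 1 − s` of the zeros of the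
open strip, `GeneralizedRH.riemannZeta_one_sub_eq_zero`; the image of an infinite window under the
injective map `s ↦ 1 − s` is an infinite subset of the reflected window). -/
theorem one_sub_mem_reAccumulationSet {σ : ℝ}
    (h : σ ∈ {σ : ℝ | ∀ ε : ℝ, 0 < ε →
        {s : ℂ | riemannZeta s = 0 ∧ 0 < s.re ∧ s.re < 1 ∧ |s.re - σ| < ε}.Infinite}) :
    1 - σ ∈ {σ : ℝ | ∀ ε : ℝ, 0 < ε →
        {s : ℂ | riemannZeta s = 0 ∧ 0 < s.re ∧ s.re < 1 ∧ |s.re - σ| < ε}.Infinite} := by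
  rw [mem_setOf_eq] at h ⊢
  intro ε hε
  have hinj : InjOn (fun s : ℂ => 1 - s)
      {s : ℂ | riemannZeta s = 0 ∧ 0 < s.re ∧ s.re < 1 ∧ |s.re - σ| < ε} :=
    fun a _ b _ hab => sub_right_injective hab
  refine ((h ε hε).image hinj).mono ?_
  rintro _ ⟨s, ⟨hz, h0, h1, hs⟩, rfl⟩
  refine ⟨Literature.NumberTheory.LFunctions.GeneralizedRH.riemannZeta_one_sub_eq_zero hz h0 h1,
    ?_, ?_, ?_⟩
  · simp only [sub_re, one_re]; linarith
  · simp only [sub_re, one_re]; linarith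
  · simp only [sub_re, one_re]
    rw [abs_sub_lt_iff] at hs ⊢
    exact ⟨by linarith [hs.2], by linarith [hs.1]⟩

/-- `A` is SYMMETRIC about `1/2`: `σ ∈ A ⟺ 1 − σ ∈ A` (functional equation). -/
theorem mem_reAccumulationSet_iff_one_sub (σ : ℝ) :
    σ ∈ {σ : ℝ | ∀ ε : ℝ, 0 < ε →
        {s : ℂ | riemannZeta s = 0 ∧ 0 < s.re ∧ s.re < 1 ∧ |s.re - σ| < ε}.Infinite} ↔
      1 - σ ∈ {σ : ℝ | ∀ ε : ℝ, 0 < ε →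
        {s : ℂ | riemannZeta s = 0 ∧ 0 < s.re ∧ s.re < 1 ∧ |s.re - σ| < ε}.Infinite} := by
  refine ⟨one_sub_mem_reAccumulationSet, fun h => ?_⟩
  have h' := one_sub_mem_reAccumulationSet h
  rwa [sub_sub_cancel] at h'

/-- `A ⊆ [0, 1]`: a window of radius `−σ` around `σ < 0`, or of radius `σ − 1` around `σ > 1`, misses
the open strip, hence is empty. -/
theorem reAccumulationSet_subset_Icc :
    {σ : ℝ | ∀ ε : ℝ, 0 < ε →
        {s : ℂ | riemannZeta s = 0 ∧ 0 < s.re ∧ s.re < 1 ∧ |s.re - σ| < ε}.Infinite} ⊆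
      Set.Icc 0 1 := by
  intro σ hσ
  by_contra hc
  rw [mem_Icc, not_and_or, not_le, not_le] at hc
  refine (notMem_reAccumulationSet_iff σ).2 ?_ hσ
  rcases hc with hc | hc
  · refine ⟨-σ, by linarith, finite_empty.subset ?_⟩
    rintro s ⟨-, h0, -, hs⟩
    rw [abs_sub_lt_iff] at hs
    exfalso
    linarith [hs.1]
  · refine ⟨σ - 1, by linarith, finite_empty.subset ?_⟩
    rintro s ⟨-, -, h1, hs⟩
    rw [abs_sub_lt_iff] at hs
    exfalso
    linarith [hs.2]

/-- COROLLARY of the picture: the crux is equivalent to `A ∩ (1/2, 1] = ∅` — by Hardy (`1/2 ∈ A`),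
the symmetry `σ ↦ 1 − σ` and `A ⊆ [0, 1]`, the accumulation set is `{1/2}` as soon as it misses the
right half `(1/2, 1]`; and `(1/2, 1] = (1/2, 1) ∪ {1}` is the split of the line into its two stubs. -/
theorem acl_iff_reAccumulationSet_inter_Ioc :
    Summit.RiemannHypothesis.RiemannHypothesis.Theses.RuelleBand.AsymptoticCriticalLine ↔
      {σ : ℝ | ∀ ε : ℝ, 0 < ε →
          {s : ℂ | riemannZeta s = 0 ∧ 0 < s.re ∧ s.re < 1 ∧ |s.re - σ| < ε}.Infinite} ∩
        Set.Ioc (1 / 2) 1 = ∅ := by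
  rw [acl_iff_reAccumulationSet, eq_empty_iff_forall_notMem]
  constructor
  · rintro hA σ ⟨hσ, h1, -⟩
    rw [hA, mem_singleton_iff] at hσ
    rw [hσ] at h1
    exact lt_irrefl _ h1
  · intro h
    refine Subset.antisymm (fun σ hσ => ?_) ?_
    · rw [mem_singleton_iff]
      have h01 : σ ∈ Icc (0 : ℝ) 1 := reAccumulationSet_subset_Icc hσ
      rcases lt_trichotomy σ (1 / 2) with hlt | heq | hgt
      · exfalso
        refine h (1 - σ) ⟨one_sub_mem_reAccumulationSet hσ, by linarith, by linarith [h01.1]⟩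
      · exact heq
      · exfalso
        exact h σ ⟨hσ, hgt, h01.2⟩
    · rintro σ rfl
      exact half_mem_reAccumulationSet

end Summit.RiemannHypothesis.RiemannHypothesis.Theorems.AsymptoticCriticalLine.InteriorEdgeSplit

end
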